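import Literature.MathematicalPhysics.QuantumFieldTheory.Balaban1983to89.T4TriangularPushforward

/-!
# T4TriangularFibredChart — the FIBRED CHART of a product measure from PRIVATE COORDINATES: the exact-law (change-of-variables)
# upgrade of the triangular push-forward `T4TriangularPushforward` (pub-balaban, row T4-D.G-AC3)

Cell `pub-ymgap` (YM-PLAN Track A), width seat `pub-ymgap-dag-n09-w6` g3 (D-0149 ∕ R399 width seat 6 of node N09 = [Balaban1987RG1] §§2–5);
helper of K1⁷ `StabilityBAtRecordR13SepCoPH` = stmt-QuantumFields-20542 (`--supports`, count-neutral).  PURPOSE ONLY — abstract measure theory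
over Mathlib and `T4TriangularPushforward`; no journal text is typed here; every declaration is elementary bookkeeping, cited to the displays
of [Balaban1987RG1] it serves.

## Why

N09's Theorem-3 doors at the Stage-13 record display ONE analytic hypothesis `hreg` («the transform of the β-input density has a continuous version
on the next small-field domain», [Balaban1987RG1] p. 259), which `Node00.RegSetOfFibredChart` (dag-n09-w6 g2) re-shaped into FIBRED-CHART DATA of the
averaging `avg` over an open coarse set `U₀`: a fibre space `Z` with measure `τ`, a measurable `Φ : (coarse) × Z → (fine)` and a Jacobian `J` with
  `hmap  : ν⌊(avg ⁻¹' U₀ ∩ S) = Φ_*(((μ⌊U₀) ⊗ τ) · J)`   and   `havgΦ : avg (Φ (V, z)) = V`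
(dag-n11-d's `hpush`∕`hfib` for the N11 δ-removal is the same shape with a constant kernel).  Print obtains such a chart from the substitution (2.10)
p. 267 around the critical configuration `V^{(k)}(W)`; its `h`-operator «`(hB)(b₀(c)) = h(c)B(c)`, `LQ̃h = I`» singles out ONE fine bond `b₀(c)` per
coarse bond `c`.  The tree's own road to the absolute continuity of the averaging laws (`BlockAveragingHaarAC`, `T4TriangularPushforward`) rests on
exactly that structure: an injection `β : κ → ι` of PRIVATE fine coordinates (the central crossing bonds) with `IsLocal β A` — the coarse coordinate
`c′` of `A U` does not see `U (β c)` for `c ≠ c′` — so that, conditionally on the environment, `A` is a product of ONE-VARIABLE maps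
`g ↦ A (update U (β c) g) c`, and RESAMPLING the private coordinates preserves the product law (`measurePreserving_resample`).
THIS FILE proves: if each one-variable map is INVERTED on an environment-dependent fine domain `Ω_c(U)` — a jointly measurable local inverse
`θ_c(U, ·)` on a coarse domain `T_c(U)` carrying the INVERSE change-of-variables law `μ⌊Ω_c(U) = θ_c(U,·)_*(j_c(U,·) · ν⌊T_c(U))` — then the
resampled map `Φ (V, U) := Function.extend β (c ↦ θ_c(U, V c)) U` with the fibre space `Z := ι → G` carrying `τ := μ^ι` ITSELF and the Jacobian
`J (V, U) := 𝟙[∀ c, V c ∈ T_c(U)] · ∏_c j_c(U, V c)` IS a fibred chart of `Measure.pi`: `hmap` with `S := {U | ∀ c, U (β c) ∈ Ω_c(U)}`, `havgΦ` on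
`{J ≠ 0}` (pointwise), hence `(J · m)`-a.e. for any `m`, and EVERYWHERE on `U₀ × Z` after splicing any measurable section of `A` over `U₀` off the good set.
No Lie algebra, no background configuration, no linearisation on the fibre: the fibre coordinates are the non-private bond variables themselves.

## Contents

§1 `map_withDensity_comp_eq` (a density pushed along the map), `withDensity_prod_eq_map_swap`, ★ `restrict_eq_map_withDensity_of_leftInvOn` (FORWARD law
`ν⌊T = ψ_*(jac · μ⌊Ω)` + measurable left inverse `θ` + `0 < jac < ∞` ⟹ INVERSE law `μ⌊Ω = θ_*((jac ∘ θ)⁻¹ · ν⌊T)` — the form in which a per-factor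
change of variables such as `HaarExpChartChangeOfVariables.haar_restrict_image_eq_map_withDensity_jacobian` enters §3), and the exact-law MIXTURE ENGINE
`restrict_prod_eq_map_withDensity_of_forall` (twin of `T4TriangularPushforward.map_prod_pi_absolutelyContinuous`).
§2 (file-private Tonelli ∕ `pi_withDensity` twins, then) ★ `pi_restrict_eq_map_withDensity_pi` (per-factor inverse laws ⟹ ONE inverse law for `μ^κ` under the
product inverse `Θ`), ★ `pi_restrict_inter_preimage_eq_map_withDensity_indicator` (the same cut down to `Ψ ⁻¹' U₀`, using the right inverse on `∏ T_c`).
§3 the chart: `measurable_oneVariable`, `measurableSet_forall_mem_fst`, `measurableSet_forall_mem_snd`, `measurableSet_fineDomain`, `measurable_triChart`,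
`measurable_triJacobian`, ★★ `apply_triChart_eq_of_forall_mem` and ★★ `apply_triChart_eq_of_jacobian_ne_zero` (`A (Φ (V,U)) = V` on the good set ∕ wherever
`J ≠ 0`), `ae_apply_triChart_eq` (the `hfib` form), ★★★ `pi_restrict_preimage_inter_eq_map_prod_withDensity` (`hmap` in `Node00.RegSetOfFibredChart`'s
orientation), and the SPLICED twins `measurable_triChartSplice`, ★★ `apply_triChartSplice_eq` (everywhere `havgΦ`),
★★★ `pi_restrict_preimage_inter_eq_map_prod_withDensity_splice`.

## What this is NOT

No chart of Bałaban's is constructed and no fibre map inverted: the per-bond data `Ω T θ j` with `hright`∕`hlaw` are HYPOTHESES.  At the record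
(`Node00.avOfRecord = BlockAveraging.blockAvg expMeanLogSU`, `β = BlockAveragingHaarAC.centralBond`, `IsLocal` = `BlockAveragingHaarAC.isLocal_avgFun`) they ask for
a measurable local inverse, with its inverse law, of the (0.4) one-variable fibre map `W ↦ exp(Σ_{i off-central} |I|⁻¹ log(V_i W*)) · W`
(`BlockAveragingEMLHaarAC.fibreMap` at `pre · g · post`) on the (2.9)-small window — a located successor piece, NOT claimed here (its local-diffeomorphism
inputs are `T4EMLTangentInjective` and `Summits/…/BalabanUVNodesN07CentralResponseOnto`).  Nothing of [Balaban1987RG1] is asserted; no estimate; `hreg` ∕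
`regSet` ∕ `TcanOfRecord` untouched; N09 NOT discharged; K1⁷ NOT closed; counts unmoved.  One finite four-torus programme at fixed `ε`; R4 closes the
conditional rung `BalabanLadder.UV` only — not ℝ⁴ ∕ infinite volume ∕ OS ∕ mass gap ∕ Clay.  No `sorry`, `axiom`, `def`, `instance`, `notation`.
-/

noncomputable section

open MeasureTheory Set Function
open scoped ENNReal NNReal

namespace Literature.MathematicalPhysics.QuantumFieldTheory.Balaban1983to89.T4TriangularFibredChart

open T4TriangularPushforward

/-! ## §1  Inverse change-of-variables laws from forward ones; the exact-law mixture engine -/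

section InverseLaw

variable {X Y : Type*} [MeasurableSpace X] [MeasurableSpace Y]

/-- Pushing a density forward along a measurable map: `ψ_*((g ∘ ψ) · m) = g · ψ_* m`.
[cite: Balaban1987RG1, (2.10) p.267 (bookkeeping: change of variables as a push-forward identity)] -/
theorem map_withDensity_comp_eq (m : Measure X) {ψ : X → Y} (hψ : Measurable ψ) {g : Y → ℝ≥0∞} (hg : Measurable g) :
    (m.withDensity fun x => g (ψ x)).map ψ = (m.map ψ).withDensity g := by
  ext s hs
  rw [Measure.map_apply hψ hs, withDensity_apply _ (hψ hs), withDensity_apply _ hs, setLIntegral_map hs hg hψ]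

/-- A density on a product, written on the swapped product: `F · (m₁ ⊗ m₂) = swap_*((F ∘ swap) · (m₂ ⊗ m₁))`.
[cite: Balaban1987RG1, (2.10) p.267 (bookkeeping: change of variables as a push-forward identity)] -/
theorem withDensity_prod_eq_map_swap (m₁ : Measure X) (m₂ : Measure Y) [SFinite m₁] [SFinite m₂] {F : X × Y → ℝ≥0∞}
    (hF : Measurable F) :
    (m₁.prod m₂).withDensity F = ((m₂.prod m₁).withDensity fun p => F p.swap).map Prod.swap := by
  rw [map_withDensity_comp_eq _ measurable_swap hF, Measure.prod_swap]

/-- ★ **INVERSE LAW FROM A FORWARD LAW.**  If `ψ` carries `jac · μ⌊Ω` to `ν⌊T` (the forward change-of-variables law of a chart, e.g. Haar measure on the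
image of a window `= ψ_*(Jacobian · Haar⌊window)`), `θ` is a measurable left inverse of `ψ` on the measurable set `Ω`, and `0 < jac < ∞` on `Ω`, then
`μ⌊Ω = θ_*((jac ∘ θ)⁻¹ · ν⌊T)` — the fine reference measure on `Ω` written in the coarse coordinate.
[cite: Balaban1987RG1, (2.10) p.267 (bookkeeping: change of variables as a push-forward identity)] -/
theorem restrict_eq_map_withDensity_of_leftInvOn {μ : Measure X} {ν : Measure Y} {Ω : Set X} (hΩ : MeasurableSet Ω) {T : Set Y}
    {ψ : X → Y} (hψ : Measurable ψ) {θ : Y → X} (hθ : Measurable θ) (hinv : ∀ x ∈ Ω, θ (ψ x) = x)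
    {jac : X → ℝ≥0∞} (hjac : Measurable jac) (h0 : ∀ x ∈ Ω, jac x ≠ 0) (htop : ∀ x ∈ Ω, jac x ≠ ∞)
    (hlaw : ν.restrict T = ((μ.restrict Ω).withDensity jac).map ψ) :
    μ.restrict Ω = ((ν.restrict T).withDensity fun y => (jac (θ y))⁻¹).map θ := by
  have hg : Measurable fun y => (jac (θ y))⁻¹ := (hjac.comp hθ).inv
  have hg' : Measurable fun x => (jac (θ (ψ x)))⁻¹ := hg.comp hψ
  have h1 : (jac * fun x => (jac (θ (ψ x)))⁻¹) =ᵐ[μ.restrict Ω] 1 := by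
    filter_upwards [ae_restrict_mem hΩ] with x hx
    simp only [Pi.mul_apply, Pi.one_apply, hinv x hx]
    exact ENNReal.mul_inv_cancel (h0 x hx) (htop x hx)
  have h2 : (θ ∘ ψ) =ᵐ[μ.restrict Ω] id := by
    filter_upwards [ae_restrict_mem hΩ] with x hx
    exact hinv x hx
  calc μ.restrict Ω = (μ.restrict Ω).map id := Measure.map_id.symm
    _ = (μ.restrict Ω).map (θ ∘ ψ) := Measure.map_congr h2.symm
    _ = ((μ.restrict Ω).withDensity (jac * fun x => (jac (θ (ψ x)))⁻¹)).map (θ ∘ ψ) := by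
        rw [withDensity_congr_ae h1, withDensity_one]
    _ = ((((μ.restrict Ω).withDensity jac).withDensity fun x => (jac (θ (ψ x)))⁻¹).map ψ).map θ := by
        rw [withDensity_mul _ hjac hg', Measure.map_map hθ hψ]
    _ = ((((μ.restrict Ω).withDensity jac).map ψ).withDensity fun y => (jac (θ y))⁻¹).map θ := by
        rw [map_withDensity_comp_eq _ hψ hg]
    _ = ((ν.restrict T).withDensity fun y => (jac (θ y))⁻¹).map θ := by rw [hlaw]

/-- **THE MIXTURE ENGINE, exact-law edition** (twin of `T4TriangularPushforward.map_prod_pi_absolutelyContinuous`): if, for every environment `U`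
and every measurable `M`, the `πκ`-measure of the section of `M ∩ R` at `U` is the `lam`-integral of `J (U, ·)` over the section at `U` of the
preimage of `M` under `(U, v) ↦ (U, Θ (U, v))`, then `(ρ ⊗ πκ)⌊R = (id × Θ)_*(J · (ρ ⊗ lam))` (Tonelli, `Measure.prod_apply`).
[cite: Balaban1987RG1, (2.10) p.267 (bookkeeping: the δ-constrained integral as an iterated integral)] -/
theorem restrict_prod_eq_map_withDensity_of_forall (ρ : Measure X) (πκ lam : Measure Y) [SFinite πκ] [SFinite lam]
    {R : Set (X × Y)} (hR : MeasurableSet R) {Θ : X × Y → Y} (hΘ : Measurable Θ) {J : X × Y → ℝ≥0∞} (hJ : Measurable J)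
    (hsec : ∀ (U : X) {M : Set (X × Y)}, MeasurableSet M →
      πκ (Prod.mk U ⁻¹' (M ∩ R)) = ∫⁻ v, ((fun q : X × Y => (q.1, Θ q)) ⁻¹' M).indicator J (U, v) ∂lam) :
    (ρ.prod πκ).restrict R = ((ρ.prod lam).withDensity J).map (fun q => (q.1, Θ q)) := by
  have hidΘ : Measurable fun q : X × Y => (q.1, Θ q) := measurable_fst.prodMk hΘ
  ext M hM
  rw [Measure.restrict_apply hM, Measure.prod_apply (hM.inter hR), Measure.map_apply hidΘ hM,
    withDensity_apply _ (hidΘ hM), ← lintegral_indicator (hidΘ hM),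
    lintegral_prod _ ((hJ.indicator (hidΘ hM)).aemeasurable)]
  exact lintegral_congr fun U => hsec U hM

end InverseLaw

/-! ## §2  Per environment: per-factor inverse laws ⟹ one inverse law for the product measure -/

section PerEnvironment

variable {κ G : Type*} [Fintype κ] [MeasurableSpace G]

omit [Fintype κ] in
/-- `∫ a · Π_{c∈s} f_c(x_c)`, marginalised over `s`, is the constant `a · Π_{c∈s} ∫ f_c dm_c` (file-private Tonelli step; twin of the private helpers of
`HaarExpChartChangeOfVariablesPi` ∕ `HaarExponentialChartProduct`). [cite: Balaban1987RG1, (0.4) p.253 (bookkeeping: product Haar measure)] -/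
private theorem lmarginal_const_mul_prod (m : κ → Measure G) [∀ c, SigmaFinite (m c)] {f : κ → G → ℝ≥0∞}
    (hf : ∀ c, Measurable (f c)) [DecidableEq κ] (s : Finset κ) :
    ∀ (a : ℝ≥0∞) (x : κ → G), (∫⋯∫⁻_s, (fun y => a * ∏ i ∈ s, f i (y i)) ∂m) x = a * ∏ i ∈ s, ∫⁻ y, f i y ∂(m i) := by
  induction s using Finset.induction_on with
  | empty =>
    intro a x
    simp only [lmarginal_empty, Finset.prod_empty, mul_one]
  | @insert i s hi ih =>
    intro a x
    have hmeas : Measurable fun y : κ → G => a * ∏ j ∈ insert i s, f j (y j) :=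
      measurable_const.mul (Finset.measurable_prod _ fun j _ => (hf j).comp (measurable_pi_apply j))
    rw [lmarginal_insert' _ hmeas hi]
    have hfun : (fun y : κ → G => ∫⁻ t, (fun z : κ → G => a * ∏ j ∈ insert i s, f j (z j)) (Function.update y i t) ∂m i)
        = fun y => (a * ∫⁻ t, f i t ∂m i) * ∏ j ∈ s, f j (y j) := by
      funext y
      have hpt : ∀ t, a * ∏ j ∈ insert i s, f j (Function.update y i t j) = (a * ∏ j ∈ s, f j (y j)) * f i t := by
        intro t
        rw [Finset.prod_insert hi, Function.update_self,
          Finset.prod_congr rfl (fun j hj => by rw [Function.update_of_ne (ne_of_mem_of_not_mem hj hi)])]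
        ring
      simp only [hpt]
      rw [lintegral_const_mul _ (hf i)]
      ring
    rw [hfun, ih, Finset.prod_insert hi]
    ring

/-- Tonelli on a finite product: `∫ Π_c f_c(x_c) d(⊗_c m_c) = Π_c ∫ f_c dm_c` (file-private twin). [cite: Balaban1987RG1, (0.4) p.253 (bookkeeping: product Haar measure)] -/
private theorem lintegral_prod_pi (m : κ → Measure G) [∀ c, SigmaFinite (m c)] {f : κ → G → ℝ≥0∞}
    (hf : ∀ c, Measurable (f c)) (x₀ : κ → G) :
    ∫⁻ x, ∏ c, f c (x c) ∂(Measure.pi m) = ∏ c, ∫⁻ y, f c y ∂(m c) := by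
  classical
  rw [lintegral_eq_lmarginal_univ x₀]
  have h := lmarginal_const_mul_prod m hf Finset.univ 1 x₀
  simp only [one_mul] at h
  exact h

/-- `⊗_c (f_c · m_c) = (Π_c f_c(x_c)) · ⊗_c m_c` (file-private twin). [cite: Balaban1987RG1, (0.4) p.253 (bookkeeping: product Haar measure)] -/
private theorem pi_withDensity (m : κ → Measure G) [∀ c, SigmaFinite (m c)] {f : κ → G → ℝ≥0∞}
    (hf : ∀ c, Measurable (f c)) [∀ c, SigmaFinite ((m c).withDensity (f c))] (x₀ : κ → G) :
    Measure.pi (fun c => (m c).withDensity (f c)) = (Measure.pi m).withDensity (fun x => ∏ c, f c (x c)) := by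
  refine Measure.pi_eq (μ := fun c => (m c).withDensity (f c)) fun s hs => ?_
  rw [withDensity_apply _ (MeasurableSet.univ_pi hs), ← lintegral_indicator (MeasurableSet.univ_pi hs)]
  have hind : (Set.pi univ s).indicator (fun x : κ → G => ∏ c, f c (x c)) = fun x => ∏ c, (s c).indicator (f c) (x c) := by
    funext x
    by_cases hx : x ∈ Set.pi univ s
    · rw [indicator_of_mem hx]
      exact Finset.prod_congr rfl fun c _ => (indicator_of_mem (hx c (mem_univ c)) _).symm
    · rw [indicator_of_notMem hx]
      simp only [Set.mem_univ_pi, not_forall] at hx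
      obtain ⟨c, hc⟩ := hx
      exact (Finset.prod_eq_zero (Finset.mem_univ c) (indicator_of_notMem hc _)).symm
  rw [hind, lintegral_prod_pi m (fun c => (hf c).indicator (hs c)) x₀]
  exact Finset.prod_congr rfl fun c _ => by rw [withDensity_apply _ (hs c), lintegral_indicator (hs c)]

variable (μ ν : Measure G) [SigmaFinite μ] [SigmaFinite ν]

/-- ★ **PER-FACTOR INVERSE LAWS ⟹ ONE INVERSE LAW FOR THE PRODUCT.**  If, for each coarse bond `c`, `μ⌊Ω_c = θ_c_*(j_c · ν⌊T_c)` (measurable `θ_c`,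
`j_c ≥ 0`), then `μ^κ⌊(∏_c Ω_c) = Θ_*((∏_c j_c(v_c)) · ν^κ⌊(∏_c T_c))` for the product inverse `Θ v := (θ_c (v c))_c`.
[cite: Balaban1987RG1, (0.4) p.253 and (2.10) p.267 (bookkeeping: product change of variables)] -/
theorem pi_restrict_eq_map_withDensity_pi [Nonempty G] (Ω T : κ → Set G) (θ : κ → G → G) (hθ : ∀ c, Measurable (θ c)) (j : κ → G → ℝ≥0)
    (hj : ∀ c, Measurable (j c))
    (hlaw : ∀ c, μ.restrict (Ω c) = ((ν.restrict (T c)).withDensity fun v => (j c v : ℝ≥0∞)).map (θ c)) :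
    (Measure.pi fun _ : κ => μ).restrict (Set.pi univ Ω) =
      (((Measure.pi fun _ : κ => ν).restrict (Set.pi univ T)).withDensity fun v => ∏ c, (j c (v c) : ℝ≥0∞)).map
        (fun v c => θ c (v c)) := by
  haveI hσ : ∀ c, SigmaFinite (((ν.restrict (T c)).withDensity fun v => (j c v : ℝ≥0∞)).map (θ c)) := fun c => by
    rw [← hlaw c]; infer_instance
  obtain ⟨x₀⟩ := (inferInstance : Nonempty G)
  have hjm : ∀ c, Measurable fun v => (j c v : ℝ≥0∞) := fun c => measurable_coe_nnreal_ennreal.comp (hj c)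
  rw [Measure.restrict_pi_pi, Measure.restrict_pi_pi]
  calc Measure.pi (fun c => μ.restrict (Ω c))
      = Measure.pi (fun c => ((ν.restrict (T c)).withDensity fun v => (j c v : ℝ≥0∞)).map (θ c)) := by
        congr 1; funext c; exact hlaw c
    _ = (Measure.pi fun c => (ν.restrict (T c)).withDensity fun v => (j c v : ℝ≥0∞)).map (fun v c => θ c (v c)) :=
        (Measure.pi_map_pi (μ := fun c => (ν.restrict (T c)).withDensity fun v => (j c v : ℝ≥0∞)) (f := fun c => θ c)
          fun c => (hθ c).aemeasurable).symm
    _ = ((Measure.pi fun c => ν.restrict (T c)).withDensity fun v => ∏ c, (j c (v c) : ℝ≥0∞)).map (fun v c => θ c (v c)) := by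
        rw [pi_withDensity (fun c => ν.restrict (T c)) (f := fun c v => (j c v : ℝ≥0∞)) hjm (fun _ => x₀)]

/-- ★ **THE SAME, CUT DOWN TO `Ψ ⁻¹' U₀`.**  If moreover `Ψ (Θ v) = v` on `∏_c T_c` (the one-variable maps `Ψ` invert the `θ_c` on the coarse domains) and
`U₀`, `T_c` are measurable, then `μ^κ⌊(Ψ ⁻¹' U₀ ∩ ∏_c Ω_c) = Θ_*((𝟙[∏_c T_c] · ∏_c j_c) · ν^κ⌊U₀)`.
[cite: Balaban1987RG1, (0.4) p.253 and (2.10) p.267 (bookkeeping: product change of variables)] -/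
theorem pi_restrict_inter_preimage_eq_map_withDensity_indicator [Nonempty G] (Ω T : κ → Set G) (hT : ∀ c, MeasurableSet (T c))
    (θ : κ → G → G) (hθ : ∀ c, Measurable (θ c)) (j : κ → G → ℝ≥0) (hj : ∀ c, Measurable (j c))
    (hlaw : ∀ c, μ.restrict (Ω c) = ((ν.restrict (T c)).withDensity fun v => (j c v : ℝ≥0∞)).map (θ c))
    {Ψ : (κ → G) → (κ → G)} (hΨ : Measurable Ψ) (hright : ∀ v ∈ Set.pi univ T, Ψ (fun c => θ c (v c)) = v)
    {U₀ : Set (κ → G)} (hU₀ : MeasurableSet U₀) :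
    (Measure.pi fun _ : κ => μ).restrict (Ψ ⁻¹' U₀ ∩ Set.pi univ Ω) =
      (((Measure.pi fun _ : κ => ν).restrict U₀).withDensity
          ((Set.pi univ T).indicator fun v => ∏ c, (j c (v c) : ℝ≥0∞))).map (fun v c => θ c (v c)) := by
  have hΘ : Measurable (fun (v : κ → G) c => θ c (v c)) := measurable_pi_lambda _ fun c => (hθ c).comp (measurable_pi_apply c)
  have hpiT : MeasurableSet (Set.pi univ T) := MeasurableSet.univ_pi hT
  rw [← Measure.restrict_restrict (hΨ hU₀), pi_restrict_eq_map_withDensity_pi μ ν Ω T θ hθ j hj hlaw,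
    Measure.restrict_map hΘ (hΨ hU₀), ← withDensity_indicator hpiT, restrict_withDensity (hΘ (hΨ hU₀)),
    ← withDensity_indicator (hΘ (hΨ hU₀)), ← withDensity_indicator hU₀]
  refine congrArg (Measure.map fun (v : κ → G) c => θ c (v c)) (congrArg (Measure.pi fun _ : κ => ν).withDensity ?_)
  funext v
  by_cases hv : v ∈ Set.pi univ T
  · have hiff : v ∈ (fun v c => θ c (v c)) ⁻¹' (Ψ ⁻¹' U₀) ↔ v ∈ U₀ := by
      show Ψ (fun c => θ c (v c)) ∈ U₀ ↔ v ∈ U₀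
      rw [hright v hv]
    by_cases hU : v ∈ U₀
    · rw [indicator_of_mem (hiff.2 hU), indicator_of_mem hU]
    · rw [indicator_of_notMem (fun h => hU (hiff.1 h)), indicator_of_notMem hU]
  · have h0 : (Set.pi univ T).indicator (fun v => ∏ c, (j c (v c) : ℝ≥0∞)) v = 0 := indicator_of_notMem hv _
    rw [Set.indicator_apply_eq_zero.2 (fun _ => h0), Set.indicator_apply_eq_zero.2 (fun _ => h0)]

end PerEnvironment

/-! ## §3  The fibred chart of `Measure.pi` from private coordinates -/

section TriChart

variable {ι κ G : Type*} [Fintype ι] [Fintype κ] [DecidableEq ι] [MeasurableSpace G]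
  {β : κ → ι} {A : (ι → G) → (κ → G)}

omit [Fintype ι] [Fintype κ] in
/-- The environment-indexed one-variable maps `(U, g) ↦ (A (update U (β c) (g c)))_c` of a measurable `A` are jointly measurable.
[cite: Balaban1987RG1, (0.4) p.253 (bookkeeping: measurability)] -/
theorem measurable_oneVariable (hAm : Measurable A) :
    Measurable fun q : (ι → G) × (κ → G) => fun c => A (update q.1 (β c) (q.2 c)) c := by
  refine measurable_pi_lambda _ fun c => (measurable_pi_apply c).comp (hAm.comp ?_)
  have h : Measurable fun q : (ι → G) × (κ → G) => (q.1, q.2 c) :=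
    measurable_fst.prodMk ((measurable_pi_apply c).comp measurable_snd)
  exact (measurable_update' (a := β c)).comp h

variable (Ω T : κ → (ι → G) → Set G) (θ : κ → (ι → G) → G → G) (j : κ → (ι → G) → G → ℝ≥0)

omit [Fintype ι] [DecidableEq ι] in
/-- Joint measurability of an environment-dependent family of one-bond windows, coarse-variable-first form:
`{(V, U) | ∀ c, V c ∈ T_c(U)}` is measurable. [cite: Balaban1987RG1, (2.9) p.266 (bookkeeping: measurability of the small-field window)] -/
theorem measurableSet_forall_mem_fst (hTm : ∀ c, MeasurableSet {p : (ι → G) × G | p.2 ∈ T c p.1}) :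
    MeasurableSet {p : (κ → G) × (ι → G) | ∀ c, p.1 c ∈ T c p.2} := by
  have : {p : (κ → G) × (ι → G) | ∀ c, p.1 c ∈ T c p.2} =
      ⋂ c, (fun p : (κ → G) × (ι → G) => (p.2, p.1 c)) ⁻¹' {p : (ι → G) × G | p.2 ∈ T c p.1} := by
    ext p; simp
  rw [this]
  exact MeasurableSet.iInter fun c => (measurable_snd.prodMk ((measurable_pi_apply c).comp measurable_fst)) (hTm c)

omit [Fintype ι] [DecidableEq ι] in
/-- The same, environment-first form: `{(U, g) | ∀ c, g c ∈ T_c(U)}` is measurable. [cite: Balaban1987RG1, (2.9) p.266 (bookkeeping: measurability of the small-field window)] -/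
theorem measurableSet_forall_mem_snd (hTm : ∀ c, MeasurableSet {p : (ι → G) × G | p.2 ∈ T c p.1}) :
    MeasurableSet {q : (ι → G) × (κ → G) | ∀ c, q.2 c ∈ T c q.1} := by
  have : {q : (ι → G) × (κ → G) | ∀ c, q.2 c ∈ T c q.1} =
      ⋂ c, (fun q : (ι → G) × (κ → G) => (q.1, q.2 c)) ⁻¹' {p : (ι → G) × G | p.2 ∈ T c p.1} := by
    ext q; simp
  rw [this]
  exact MeasurableSet.iInter fun c => (measurable_fst.prodMk ((measurable_pi_apply c).comp measurable_snd)) (hTm c)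

omit [Fintype ι] [DecidableEq ι] in
/-- The charted fine set `S = {U | ∀ c, U (β c) ∈ Ω_c(U)}` is measurable when the fine domains are jointly measurable.
[cite: Balaban1987RG1, (2.9) p.266 (bookkeeping: measurability of the small-field window)] -/
theorem measurableSet_fineDomain (hΩm : ∀ c, MeasurableSet {p : (ι → G) × G | p.2 ∈ Ω c p.1}) :
    MeasurableSet {U : ι → G | ∀ c, U (β c) ∈ Ω c U} := by
  have : {U : ι → G | ∀ c, U (β c) ∈ Ω c U} = ⋂ c, (fun U : ι → G => (U, U (β c))) ⁻¹' {p : (ι → G) × G | p.2 ∈ Ω c p.1} := by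
    ext U; simp
  rw [this]
  exact MeasurableSet.iInter fun c => (measurable_id.prodMk (measurable_pi_apply (β c))) (hΩm c)

omit [Fintype κ] [DecidableEq ι] in
/-- The resampled chart `Φ (V, U) = extend β (c ↦ θ_c(U, V c)) U` is measurable. [cite: Balaban1987RG1, (2.10) p.267 (bookkeeping: measurability of the chart)] -/
theorem measurable_triChart (hβ : Injective β) (hθm : ∀ c, Measurable fun p : (ι → G) × G => θ c p.1 p.2) :
    Measurable fun p : (κ → G) × (ι → G) => extend β (fun c => θ c p.2 (p.1 c)) p.2 := by
  have h1 : Measurable fun p : (κ → G) × (ι → G) => (p.2, fun c => θ c p.2 (p.1 c)) :=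
    measurable_snd.prodMk (measurable_pi_lambda _ fun c =>
      (hθm c).comp (measurable_snd.prodMk ((measurable_pi_apply c).comp measurable_fst)))
  exact (measurable_resample hβ).comp h1

omit [Fintype ι] [DecidableEq ι] in
/-- The Jacobian `J (V, U) = 𝟙[∀ c, V c ∈ T_c(U)] · ∏_c j_c(U, V c)` is measurable. [cite: Balaban1987RG1, (2.10) p.267 (bookkeeping: measurability of the Jacobian)] -/
theorem measurable_triJacobian (hTm : ∀ c, MeasurableSet {p : (ι → G) × G | p.2 ∈ T c p.1})
    (hjm : ∀ c, Measurable fun p : (ι → G) × G => j c p.1 p.2) :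
    Measurable fun p : (κ → G) × (ι → G) =>
      {p : (κ → G) × (ι → G) | ∀ c, p.1 c ∈ T c p.2}.indicator (fun p => ∏ c, j c p.2 (p.1 c)) p := by
  refine Measurable.indicator ?_ (measurableSet_forall_mem_fst T hTm)
  exact Finset.measurable_prod _ fun c _ => (hjm c).comp (measurable_snd.prodMk ((measurable_pi_apply c).comp measurable_fst))

omit [Fintype ι] [MeasurableSpace G] in
/-- ★★ **THE CHART LIES OVER THE COARSE VARIABLE ON THE GOOD SET.**  If each `θ_c(U, ·)` is a right inverse of the one-variable map
`g ↦ A (update U (β c) g) c` on `T_c(U)` and `A` is local with `β` injective, then `A (Φ (V, U)) = V` whenever `V c ∈ T_c(U)` for all `c`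
(`T4TriangularPushforward.apply_resample_eq`). [cite: Balaban1987RG1, (2.4) p.266 and (2.10) p.267 (bookkeeping: the chart parametrises the fibre)] -/
theorem apply_triChart_eq_of_forall_mem (hA : IsLocal β A) (hβ : Injective β)
    (hright : ∀ c U, ∀ v ∈ T c U, A (update U (β c) (θ c U v)) c = v)
    {V : κ → G} {U : ι → G} (hV : ∀ c, V c ∈ T c U) :
    A (extend β (fun c => θ c U (V c)) U) = V := by
  funext c
  rw [apply_resample_eq hA hβ U (fun c => θ c U (V c)) c]
  exact hright c U (V c) (hV c)

omit [Fintype ι] [MeasurableSpace G] in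
/-- ★★ **… IN PARTICULAR WHEREVER THE JACOBIAN IS NON-ZERO** (the indicator in `J` vanishes off the good set): `J (V, U) ≠ 0 → A (Φ (V, U)) = V`.
[cite: Balaban1987RG1, (2.4) p.266 and (2.10) p.267 (bookkeeping: the chart parametrises the fibre)] -/
theorem apply_triChart_eq_of_jacobian_ne_zero (hA : IsLocal β A) (hβ : Injective β)
    (hright : ∀ c U, ∀ v ∈ T c U, A (update U (β c) (θ c U v)) c = v) {V : κ → G} {U : ι → G}
    (hJ : {p : (κ → G) × (ι → G) | ∀ c, p.1 c ∈ T c p.2}.indicator (fun p => ∏ c, j c p.2 (p.1 c)) (V, U) ≠ 0) :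
    A (extend β (fun c => θ c U (V c)) U) = V := by
  refine apply_triChart_eq_of_forall_mem T θ hA hβ hright fun c => ?_
  by_contra hc
  exact hJ (indicator_of_notMem (show (V, U) ∉ {p : (κ → G) × (ι → G) | ∀ c, p.1 c ∈ T c p.2} from fun h => hc (h c)) _)

omit [Fintype ι] in
/-- The `hfib` form: for ANY measure `m` on `(κ → G) × (ι → G)`, `A (Φ p) = p.1` holds `(J · m)`-almost everywhere.
[cite: Balaban1987RG1, (2.4) p.266 and (2.10) p.267 (bookkeeping: the chart parametrises the fibre)] -/
theorem ae_apply_triChart_eq (hA : IsLocal β A) (hβ : Injective β)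
    (hright : ∀ c U, ∀ v ∈ T c U, A (update U (β c) (θ c U v)) c = v)
    (hTm : ∀ c, MeasurableSet {p : (ι → G) × G | p.2 ∈ T c p.1}) (hjm : ∀ c, Measurable fun p : (ι → G) × G => j c p.1 p.2)
    (m : Measure ((κ → G) × (ι → G))) :
    ∀ᵐ p ∂(m.withDensity fun p =>
        (({p : (κ → G) × (ι → G) | ∀ c, p.1 c ∈ T c p.2}.indicator (fun p => ∏ c, j c p.2 (p.1 c)) p : ℝ≥0) : ℝ≥0∞)),
      A (extend β (fun c => θ c p.2 (p.1 c)) p.2) = p.1 := by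
  have hJm : Measurable fun p : (κ → G) × (ι → G) =>
      (({p : (κ → G) × (ι → G) | ∀ c, p.1 c ∈ T c p.2}.indicator (fun p => ∏ c, j c p.2 (p.1 c)) p : ℝ≥0) : ℝ≥0∞) :=
    measurable_coe_nnreal_ennreal.comp (measurable_triJacobian T j hTm hjm)
  rw [ae_withDensity_iff hJm]
  refine ae_of_all _ fun p hp => ?_
  exact apply_triChart_eq_of_jacobian_ne_zero T θ j hA hβ hright (fun h => hp (by rw [h, ENNReal.coe_zero]))

variable (μ : Measure G) [IsProbabilityMeasure μ] (ν : Measure G) [SigmaFinite ν]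

/-- ★★★ **THE FIBRED CHART OF A PRODUCT MEASURE FROM PRIVATE COORDINATES** (`hmap` of `Node00.RegSetOfFibredChart` for `Measure.pi`).
SETTING: finite bond types `ι ⊇ β(κ)` (`β` injective), a probability measure `μ` (fine one-bond reference) and a σ-finite `ν` (coarse one-bond reference) on `G`,
a measurable averaging `A : (ι → G) → (κ → G)` with `IsLocal β A`; per coarse bond `c`, jointly measurable data: a fine domain `Ω_c(U)` BLIND to the private
coordinates of the environment `U` (`hΩbl`), a coarse domain `T_c(U)`, a local inverse `θ_c(U, ·)` and a density `j_c(U, ·) ≥ 0` with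
`hright : A (update U (β c) (θ_c(U, v))) c = v` for `v ∈ T_c(U)` and the INVERSE LAW `hlaw : μ⌊Ω_c(U) = θ_c(U,·)_*(j_c(U,·) · ν⌊T_c(U))`.
CONCLUSION: for every measurable coarse set `U₀`,
`μ^ι⌊(A ⁻¹' U₀ ∩ {U | ∀ c, U (β c) ∈ Ω_c(U)}) = Φ_*((((ν^κ)⌊U₀) ⊗ μ^ι) · J)` with `Φ (V, U) = extend β (c ↦ θ_c(U, V c)) U` and
`J (V, U) = 𝟙[∀ c, V c ∈ T_c(U)] · ∏_c j_c(U, V c)`.  PROOF: resampling (`measurePreserving_resample`) writes `μ^ι` as the law of `extend β g U` under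
`μ^ι ⊗ μ^κ`; by locality `A (extend β g U) = (A (update U (β c) (g c)) c)_c`; conditionally on `U` the §2 product change of variables applies; Tonelli.
[cite: Balaban1987RG1, (0.4) p.253, (2.4) p.266 and (2.10) p.267 (bookkeeping: the δ-constrained fine integral in chart coordinates)] -/
theorem pi_restrict_preimage_inter_eq_map_prod_withDensity [Nonempty G] (hA : IsLocal β A) (hβ : Injective β) (hAm : Measurable A)
    (hΩm : ∀ c, MeasurableSet {p : (ι → G) × G | p.2 ∈ Ω c p.1}) (hTm : ∀ c, MeasurableSet {p : (ι → G) × G | p.2 ∈ T c p.1})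
    (hθm : ∀ c, Measurable fun p : (ι → G) × G => θ c p.1 p.2) (hjm : ∀ c, Measurable fun p : (ι → G) × G => j c p.1 p.2)
    (hΩbl : ∀ c (U : ι → G) (g : κ → G), Ω c (extend β g U) = Ω c U)
    (hright : ∀ c U, ∀ v ∈ T c U, A (update U (β c) (θ c U v)) c = v)
    (hlaw : ∀ c U, μ.restrict (Ω c U) = ((ν.restrict (T c U)).withDensity fun v => (j c U v : ℝ≥0∞)).map (θ c U))
    {U₀ : Set (κ → G)} (hU₀ : MeasurableSet U₀) :
    (Measure.pi fun _ : ι => μ).restrict (A ⁻¹' U₀ ∩ {U | ∀ c, U (β c) ∈ Ω c U}) =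
      ((((Measure.pi fun _ : κ => ν).restrict U₀).prod (Measure.pi fun _ : ι => μ)).withDensity fun p =>
          (({p : (κ → G) × (ι → G) | ∀ c, p.1 c ∈ T c p.2}.indicator (fun p => ∏ c, j c p.2 (p.1 c)) p : ℝ≥0) : ℝ≥0∞)).map
        (fun p : (κ → G) × (ι → G) => extend β (fun c => θ c p.2 (p.1 c)) p.2) := by
  classical
  -- measurability bookkeeping
  have hres : Measurable fun q : (ι → G) × (κ → G) => extend β q.2 q.1 := measurable_resample hβ
  have hΨ : Measurable fun q : (ι → G) × (κ → G) => fun c => A (update q.1 (β c) (q.2 c)) c := measurable_oneVariable hAm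
  have hΘ : Measurable fun q : (ι → G) × (κ → G) => fun c => θ c q.1 (q.2 c) :=
    measurable_pi_lambda _ fun c => (hθm c).comp (measurable_fst.prodMk ((measurable_pi_apply c).comp measurable_snd))
  have hidΘ : Measurable fun q : (ι → G) × (κ → G) => (q.1, fun c => θ c q.1 (q.2 c)) := measurable_fst.prodMk hΘ
  have hR : MeasurableSet {q : (ι → G) × (κ → G) | (fun c => A (update q.1 (β c) (q.2 c)) c) ∈ U₀ ∧ ∀ c, q.2 c ∈ Ω c q.1} :=
    (hΨ hU₀).inter (measurableSet_forall_mem_snd Ω hΩm)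
  -- the Jacobian in the environment-first orientation, and its measurability
  have hJωeq : (fun q : (ι → G) × (κ → G) =>
        (Set.pi univ fun c => T c q.1).indicator (fun v => ∏ c, (j c q.1 (v c) : ℝ≥0∞)) q.2) =
      {q : (ι → G) × (κ → G) | ∀ c, q.2 c ∈ T c q.1}.indicator fun q => ∏ c, (j c q.1 (q.2 c) : ℝ≥0∞) := by
    funext q
    by_cases hq : ∀ c, q.2 c ∈ T c q.1
    · rw [indicator_of_mem (show q.2 ∈ Set.pi univ (fun c => T c q.1) from fun c _ => hq c),
        indicator_of_mem (show q ∈ {q : (ι → G) × (κ → G) | ∀ c, q.2 c ∈ T c q.1} from hq)]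
    · rw [indicator_of_notMem (show q.2 ∉ Set.pi univ (fun c => T c q.1) from fun h => hq fun c => h c (mem_univ c)),
        indicator_of_notMem (show q ∉ {q : (ι → G) × (κ → G) | ∀ c, q.2 c ∈ T c q.1} from hq)]
  have hJω : Measurable fun q : (ι → G) × (κ → G) =>
      (Set.pi univ fun c => T c q.1).indicator (fun v => ∏ c, (j c q.1 (v c) : ℝ≥0∞)) q.2 := by
    rw [hJωeq]
    exact Measurable.indicator (Finset.measurable_prod _ fun c _ =>
      (measurable_coe_nnreal_ennreal.comp (hjm c)).comp (measurable_fst.prodMk ((measurable_pi_apply c).comp measurable_snd)))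
      (measurableSet_forall_mem_snd T hTm)
  -- STEP 1 (per environment `U`): §2 at the sections
  have hsec : ∀ (U : ι → G) {M : Set ((ι → G) × (κ → G))}, MeasurableSet M →
      (Measure.pi fun _ : κ => μ) (Prod.mk U ⁻¹'
        (M ∩ {q : (ι → G) × (κ → G) | (fun c => A (update q.1 (β c) (q.2 c)) c) ∈ U₀ ∧ ∀ c, q.2 c ∈ Ω c q.1})) =
      ∫⁻ v, ((fun q : (ι → G) × (κ → G) => (q.1, fun c => θ c q.1 (q.2 c))) ⁻¹' M).indicator
        (fun q => (Set.pi univ fun c => T c q.1).indicator (fun v => ∏ c, (j c q.1 (v c) : ℝ≥0∞)) q.2) (U, v)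
        ∂((Measure.pi fun _ : κ => ν).restrict U₀) := by
    intro U M hM
    have hΨU : Measurable fun g : κ → G => fun c => A (update U (β c) (g c)) c := hΨ.comp (measurable_const.prodMk measurable_id)
    have hΘU : Measurable fun v : κ → G => fun c => θ c U (v c) := hΘ.comp (measurable_const.prodMk measurable_id)
    have hsecM : MeasurableSet (Prod.mk U ⁻¹' M) := measurable_prodMk_left hM
    have hpre : Prod.mk U ⁻¹' (M ∩ {q : (ι → G) × (κ → G) | (fun c => A (update q.1 (β c) (q.2 c)) c) ∈ U₀ ∧ ∀ c, q.2 c ∈ Ω c q.1}) =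
        Prod.mk U ⁻¹' M ∩ ((fun g : κ → G => fun c => A (update U (β c) (g c)) c) ⁻¹' U₀ ∩ Set.pi univ fun c => Ω c U) := by
      ext g
      simp only [mem_preimage, mem_inter_iff, mem_setOf_eq, mem_univ_pi]
    have hper := pi_restrict_inter_preimage_eq_map_withDensity_indicator μ ν (fun c => Ω c U) (fun c => T c U)
      (fun c => (measurable_const.prodMk measurable_id) (hTm c)) (fun c => θ c U)
      (fun c => (hθm c).comp (measurable_const.prodMk measurable_id)) (fun c => j c U)
      (fun c => (hjm c).comp (measurable_const.prodMk measurable_id)) (fun c => hlaw c U) hΨU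
      (fun v hv => funext fun c => hright c U (v c) (hv c (mem_univ c))) hU₀
    rw [hpre, ← Measure.restrict_apply hsecM, hper, Measure.map_apply hΘU hsecM, withDensity_apply _ (hΘU hsecM),
      ← lintegral_indicator (hΘU hsecM)]
    exact lintegral_congr fun v => rfl
  -- STEP 2 (integrate over environments): the exact-law mixture engine
  have hR_eq := restrict_prod_eq_map_withDensity_of_forall (Measure.pi fun _ : ι => μ) (Measure.pi fun _ : κ => μ)
    ((Measure.pi fun _ : κ => ν).restrict U₀) hR hΘ hJω hsec
  -- STEP 3 (resampling, then swapping the factors into the consumer's orientation)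
  have hpreR : (fun q : (ι → G) × (κ → G) => extend β q.2 q.1) ⁻¹' (A ⁻¹' U₀ ∩ {U | ∀ c, U (β c) ∈ Ω c U}) =
      {q : (ι → G) × (κ → G) | (fun c => A (update q.1 (β c) (q.2 c)) c) ∈ U₀ ∧ ∀ c, q.2 c ∈ Ω c q.1} := by
    ext q
    have h1 : A (extend β q.2 q.1) = fun c => A (update q.1 (β c) (q.2 c)) c := funext fun c => apply_resample_eq hA hβ q.1 q.2 c
    have h2 : ∀ c, extend β q.2 q.1 (β c) = q.2 c := fun c => hβ.extend_apply _ _ _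
    have h3 : ∀ c, Ω c (extend β q.2 q.1) = Ω c q.1 := fun c => hΩbl c q.1 q.2
    simp only [mem_preimage, mem_inter_iff, mem_setOf_eq, h1, h2, h3]
  have hmp := measurePreserving_resample μ hβ
  have hS : MeasurableSet (A ⁻¹' U₀ ∩ {U | ∀ c, U (β c) ∈ Ω c U}) := (hAm hU₀).inter (measurableSet_fineDomain Ω hΩm)
  calc (Measure.pi fun _ : ι => μ).restrict (A ⁻¹' U₀ ∩ {U | ∀ c, U (β c) ∈ Ω c U})
      = (((Measure.pi fun _ : ι => μ).prod (Measure.pi fun _ : κ => μ)).map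
          (fun q : (ι → G) × (κ → G) => extend β q.2 q.1)).restrict (A ⁻¹' U₀ ∩ {U | ∀ c, U (β c) ∈ Ω c U}) := by
        rw [hmp.map_eq]
    _ = (((Measure.pi fun _ : ι => μ).prod (Measure.pi fun _ : κ => μ)).restrict
          {q : (ι → G) × (κ → G) | (fun c => A (update q.1 (β c) (q.2 c)) c) ∈ U₀ ∧ ∀ c, q.2 c ∈ Ω c q.1}).map
          (fun q : (ι → G) × (κ → G) => extend β q.2 q.1) := by
        rw [Measure.restrict_map hres hS, hpreR]
    _ = ((((Measure.pi fun _ : ι => μ).prod ((Measure.pi fun _ : κ => ν).restrict U₀)).withDensity fun q =>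
            (Set.pi univ fun c => T c q.1).indicator (fun v => ∏ c, (j c q.1 (v c) : ℝ≥0∞)) q.2).map
          (fun q : (ι → G) × (κ → G) => (q.1, fun c => θ c q.1 (q.2 c)))).map
          (fun q : (ι → G) × (κ → G) => extend β q.2 q.1) := by
        rw [hR_eq]
    _ = (((Measure.pi fun _ : ι => μ).prod ((Measure.pi fun _ : κ => ν).restrict U₀)).withDensity fun q =>
            (Set.pi univ fun c => T c q.1).indicator (fun v => ∏ c, (j c q.1 (v c) : ℝ≥0∞)) q.2).map
          ((fun q : (ι → G) × (κ → G) => extend β q.2 q.1) ∘ fun q : (ι → G) × (κ → G) => (q.1, fun c => θ c q.1 (q.2 c))) :=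
        Measure.map_map hres hidΘ
    _ = (((((Measure.pi fun _ : κ => ν).restrict U₀).prod (Measure.pi fun _ : ι => μ)).withDensity fun p =>
            (Set.pi univ fun c => T c p.swap.1).indicator (fun v => ∏ c, (j c p.swap.1 (v c) : ℝ≥0∞)) p.swap.2).map Prod.swap).map
          ((fun q : (ι → G) × (κ → G) => extend β q.2 q.1) ∘ fun q : (ι → G) × (κ → G) => (q.1, fun c => θ c q.1 (q.2 c))) := by
        rw [withDensity_prod_eq_map_swap _ _ hJω]
    _ = ((((Measure.pi fun _ : κ => ν).restrict U₀).prod (Measure.pi fun _ : ι => μ)).withDensity fun p =>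
            (Set.pi univ fun c => T c p.swap.1).indicator (fun v => ∏ c, (j c p.swap.1 (v c) : ℝ≥0∞)) p.swap.2).map
          (((fun q : (ι → G) × (κ → G) => extend β q.2 q.1) ∘ fun q : (ι → G) × (κ → G) => (q.1, fun c => θ c q.1 (q.2 c))) ∘
            Prod.swap) :=
        Measure.map_map (hres.comp hidΘ) measurable_swap
    _ = _ := by
        have hfun : (((fun q : (ι → G) × (κ → G) => extend β q.2 q.1) ∘
              fun q : (ι → G) × (κ → G) => (q.1, fun c => θ c q.1 (q.2 c))) ∘ Prod.swap) =
            fun p : (κ → G) × (ι → G) => extend β (fun c => θ c p.2 (p.1 c)) p.2 := by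
          funext p; rfl
        have hden : (fun p : (κ → G) × (ι → G) =>
              (Set.pi univ fun c => T c p.swap.1).indicator (fun v => ∏ c, (j c p.swap.1 (v c) : ℝ≥0∞)) p.swap.2) =
            fun p => (({p : (κ → G) × (ι → G) | ∀ c, p.1 c ∈ T c p.2}.indicator (fun p => ∏ c, j c p.2 (p.1 c)) p : ℝ≥0) : ℝ≥0∞) := by
          funext p
          show (Set.pi univ fun c => T c p.2).indicator (fun v => ∏ c, (j c p.2 (v c) : ℝ≥0∞)) p.1 =
            (({p : (κ → G) × (ι → G) | ∀ c, p.1 c ∈ T c p.2}.indicator (fun p => ∏ c, j c p.2 (p.1 c)) p : ℝ≥0) : ℝ≥0∞)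
          rw [ENNReal.coe_indicator]
          by_cases hp : ∀ c, p.1 c ∈ T c p.2
          · rw [indicator_of_mem (show p.1 ∈ Set.pi univ (fun c => T c p.2) from fun c _ => hp c),
              indicator_of_mem (show p ∈ {p : (κ → G) × (ι → G) | ∀ c, p.1 c ∈ T c p.2} from hp), ENNReal.ofNNReal_finsetProd]
          · rw [indicator_of_notMem (show p.1 ∉ Set.pi univ (fun c => T c p.2) from fun h => hp fun c => h c (mem_univ c)),
              indicator_of_notMem (show p ∉ {p : (κ → G) × (ι → G) | ∀ c, p.1 c ∈ T c p.2} from hp)]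
        rw [hfun, hden]

omit [DecidableEq ι] in
/-- The SPLICED chart `Φ′ = Φ` on the good set `{∀ c, V c ∈ T_c(U)}`, `= σ V` off it (any measurable `σ`) is measurable.
[cite: Balaban1987RG1, (2.10) p.267 (bookkeeping: measurability of the chart)] -/
theorem measurable_triChartSplice (hβ : Injective β) (hTm : ∀ c, MeasurableSet {p : (ι → G) × G | p.2 ∈ T c p.1})
    (hθm : ∀ c, Measurable fun p : (ι → G) × G => θ c p.1 p.2) {σ : (κ → G) → (ι → G)} (hσ : Measurable σ)
    [DecidablePred (· ∈ {p : (κ → G) × (ι → G) | ∀ c, p.1 c ∈ T c p.2})] :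
    Measurable ({p : (κ → G) × (ι → G) | ∀ c, p.1 c ∈ T c p.2}.piecewise
      (fun p => extend β (fun c => θ c p.2 (p.1 c)) p.2) (fun p => σ p.1)) :=
  Measurable.piecewise (measurableSet_forall_mem_fst T hTm) (measurable_triChart θ hβ hθm) (hσ.comp measurable_fst)

omit [Fintype ι] [MeasurableSpace G] in
/-- ★★ **EVERYWHERE `havgΦ` FOR THE SPLICED CHART**: if `σ` is a section of `A` over `U₀` (`A (σ V) = V` for `V ∈ U₀`), then
`A (Φ′ (V, U)) = V` for every `V ∈ U₀` and EVERY `U` — the hypothesis shape `havgΦ` of `Node00.RegSetOfFibredChart` verbatim.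
[cite: Balaban1987RG1, (2.4) p.266 and (2.10) p.267 (bookkeeping: the chart parametrises the fibre)] -/
theorem apply_triChartSplice_eq (hA : IsLocal β A) (hβ : Injective β)
    (hright : ∀ c U, ∀ v ∈ T c U, A (update U (β c) (θ c U v)) c = v) {σ : (κ → G) → (ι → G)} {U₀ : Set (κ → G)}
    (hσA : ∀ V ∈ U₀, A (σ V) = V) [DecidablePred (· ∈ {p : (κ → G) × (ι → G) | ∀ c, p.1 c ∈ T c p.2})] :
    ∀ V ∈ U₀, ∀ U : ι → G, A ({p : (κ → G) × (ι → G) | ∀ c, p.1 c ∈ T c p.2}.piecewise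
      (fun p => extend β (fun c => θ c p.2 (p.1 c)) p.2) (fun p => σ p.1) (V, U)) = V := by
  intro V hV U
  by_cases h : (V, U) ∈ {p : (κ → G) × (ι → G) | ∀ c, p.1 c ∈ T c p.2}
  · rw [piecewise_eq_of_mem _ _ _ h]
    exact apply_triChart_eq_of_forall_mem T θ hA hβ hright h
  · rw [piecewise_eq_of_notMem _ _ _ h]
    exact hσA V hV

/-- ★★★ **`hmap` FOR THE SPLICED CHART** (same right member: the splice changes `Φ` only where `J = 0`).  Together with `apply_triChartSplice_eq` this is
the pair (`hmap`, `havgΦ`) of `Node00.RegSetOfFibredChart` §2 ∕ §5 for `Measure.pi`, for any section `σ` of `A` over `U₀` (no measurability of `σ` is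
needed for this identity: the two charts agree `(J · ((ν^κ⌊U₀) ⊗ μ^ι))`-a.e.).
[cite: Balaban1987RG1, (0.4) p.253, (2.4) p.266 and (2.10) p.267 (bookkeeping: the δ-constrained fine integral in chart coordinates)] -/
theorem pi_restrict_preimage_inter_eq_map_prod_withDensity_splice [Nonempty G] (hA : IsLocal β A) (hβ : Injective β) (hAm : Measurable A)
    (hΩm : ∀ c, MeasurableSet {p : (ι → G) × G | p.2 ∈ Ω c p.1}) (hTm : ∀ c, MeasurableSet {p : (ι → G) × G | p.2 ∈ T c p.1})
    (hθm : ∀ c, Measurable fun p : (ι → G) × G => θ c p.1 p.2) (hjm : ∀ c, Measurable fun p : (ι → G) × G => j c p.1 p.2)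
    (hΩbl : ∀ c (U : ι → G) (g : κ → G), Ω c (extend β g U) = Ω c U)
    (hright : ∀ c U, ∀ v ∈ T c U, A (update U (β c) (θ c U v)) c = v)
    (hlaw : ∀ c U, μ.restrict (Ω c U) = ((ν.restrict (T c U)).withDensity fun v => (j c U v : ℝ≥0∞)).map (θ c U))
    (σ : (κ → G) → (ι → G)) [DecidablePred (· ∈ {p : (κ → G) × (ι → G) | ∀ c, p.1 c ∈ T c p.2})]
    {U₀ : Set (κ → G)} (hU₀ : MeasurableSet U₀) :
    (Measure.pi fun _ : ι => μ).restrict (A ⁻¹' U₀ ∩ {U | ∀ c, U (β c) ∈ Ω c U}) =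
      ((((Measure.pi fun _ : κ => ν).restrict U₀).prod (Measure.pi fun _ : ι => μ)).withDensity fun p =>
          (({p : (κ → G) × (ι → G) | ∀ c, p.1 c ∈ T c p.2}.indicator (fun p => ∏ c, j c p.2 (p.1 c)) p : ℝ≥0) : ℝ≥0∞)).map
        ({p : (κ → G) × (ι → G) | ∀ c, p.1 c ∈ T c p.2}.piecewise
          (fun p => extend β (fun c => θ c p.2 (p.1 c)) p.2) (fun p => σ p.1)) := by
  have hJm : Measurable fun p : (κ → G) × (ι → G) =>
      (({p : (κ → G) × (ι → G) | ∀ c, p.1 c ∈ T c p.2}.indicator (fun p => ∏ c, j c p.2 (p.1 c)) p : ℝ≥0) : ℝ≥0∞) :=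
    measurable_coe_nnreal_ennreal.comp (measurable_triJacobian T j hTm hjm)
  rw [pi_restrict_preimage_inter_eq_map_prod_withDensity Ω T θ j μ ν hA hβ hAm hΩm hTm hθm hjm hΩbl hright hlaw hU₀]
  refine Measure.map_congr ?_
  rw [Filter.EventuallyEq, ae_withDensity_iff hJm]
  refine ae_of_all _ fun p hp => ?_
  have hmem : p ∈ {p : (κ → G) × (ι → G) | ∀ c, p.1 c ∈ T c p.2} := by
    by_contra h
    exact hp (by rw [indicator_of_notMem h, ENNReal.coe_zero])
  rw [piecewise_eq_of_mem _ _ _ hmem]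

end TriChart

end Literature.MathematicalPhysics.QuantumFieldTheory.Balaban1983to89.T4TriangularFibredChart

end
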